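import Summits.ValiantsHypothesis.ValiantsHypothesis.Theorems.FeketeSOSHard.Negative.TameOperatorCube

/-!
# `FeketeSOS.FeketeSOSHard` (stmt-ValiantsHypothesis-3996) — negative side: the rank-2 cube pattern
# `Π_{i<J} (1 + X^{3^i} − X^{2·3^i})` and its golden-ratio factorisation

Part 2 of the refutation of the registered stub `stub_tameOperator` (line `Cruxes/FeketeSOSHard/Lines/paley_rip_v3.lean`),
by the seat val-width-3996-p5 (g3); part 1 is `…Negative/TameOperatorCube.lean` (the cube `S J` and the dual witness
`z J`, orthogonality `cube_orth`).  Objects again enter as HYPOTHESES (no definitions):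

* `Y : ℕ → ℂ[X]`, `Y 0 = 1`, `Y (J+1) = Y J · (1 + X^{3^J} − X^{2·3^J})` — the pattern; `patY_coeff_eq_zero`
  (`deg < 3^J`), `norm_patY_coeff_le_one` (digits are unique, so every coefficient is `±1` or `0`: sup norm `M = 1`),
  and the value of the dual functional `dual_patY`: `Σ_{n<3^J} z(n) (Y J)_n = 5^J` (per digit `2·1 + 1·1 + (−2)(−1) = 5`);
* `U (J+1) = U J · (a − X^{3^J})`, `V (J+1) = V J · (X^{3^J} − b)` with `ab = −1`, `a + b = 1` (instantiated in part 3
  with the golden ratio `a = φ`, `b = ψ`): `patU_mul_patV` (`U J · V J = Y J`, since `(a − t)(t − b) = 1 + t − t²`),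
  `patU_support`, `patV_support` (`⊆ S J`), and the two-squares identity `P Q = ¼(P+Q)² − ¼(P−Q)²` in the stub's format
  (`sum_two_squares_eq`): the pattern `Y J` is carried by `r = 2` weighted squares supported in the cube.

Part 3 (`…Negative/TameOperatorFalse.lean`) derives the mass floor `5^{J/2}` and the contradiction.  Elementary; no facts,
no definitions. [folklore]  Honest framing: kills a STUB of one line; the crux, the engine and `VP ≠ VNP` are untouched.
-/

-- `Summit.ValiantsHypothesis.ValiantsHypothesis.…` is the tree's namespace convention (summit = problem here).
set_option linter.dupNamespace false

namespace Summit.ValiantsHypothesis.ValiantsHypothesis.Theorems.FeketeSOSHard.Negative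

open Finset
open scoped BigOperators

noncomputable section

/-! ## Block multiplication by a trinomial `a + b X^N + c X^{2N}` -/

section Trinomial

open Polynomial

/-- Coefficients of `P · (a + b X^N + c X^{2N})`. [folklore] -/
theorem coeff_mul_trinomial (P : ℂ[X]) (N : ℕ) (a b c : ℂ) (m : ℕ) :
    (P * (C a + C b * X ^ N + C c * X ^ (2 * N))).coeff m =
      a * P.coeff m + b * (if N ≤ m then P.coeff (m - N) else 0) +
        c * (if 2 * N ≤ m then P.coeff (m - 2 * N) else 0) := by
  have e : P * (C a + C b * X ^ N + C c * X ^ (2 * N)) =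
      C a * P + C b * (P * X ^ N) + C c * (P * X ^ (2 * N)) := by ring
  rw [e, coeff_add, coeff_add, coeff_C_mul, coeff_C_mul, coeff_C_mul, coeff_mul_X_pow', coeff_mul_X_pow']

/-- Low block: coefficient `a · P_σ` at `σ < N`. [folklore] -/
theorem coeff_mul_trinomial_low (P : ℂ[X]) (N : ℕ) (a b c : ℂ) (σ : ℕ) (hσ : σ < N) :
    (P * (C a + C b * X ^ N + C c * X ^ (2 * N))).coeff σ = a * P.coeff σ := by
  rw [coeff_mul_trinomial, if_neg (by omega), if_neg (by omega)]; ring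

/-- Middle block: coefficient `b · P_σ` at `N + σ`, `σ < N`, when `P` lives on `[0,N)`. [folklore] -/
theorem coeff_mul_trinomial_mid (P : ℂ[X]) (N : ℕ) (hP : ∀ m, N ≤ m → P.coeff m = 0) (a b c : ℂ)
    (σ : ℕ) (hσ : σ < N) :
    (P * (C a + C b * X ^ N + C c * X ^ (2 * N))).coeff (N + σ) = b * P.coeff σ := by
  rw [coeff_mul_trinomial, if_pos (by omega), if_neg (by omega), hP _ (by omega), Nat.add_sub_cancel_left]
  ring

/-- High block: coefficient `c · P_σ` at `2N + σ`, `σ < N`, when `P` lives on `[0,N)`. [folklore] -/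
theorem coeff_mul_trinomial_high (P : ℂ[X]) (N : ℕ) (hP : ∀ m, N ≤ m → P.coeff m = 0) (a b c : ℂ)
    (σ : ℕ) (hσ : σ < N) :
    (P * (C a + C b * X ^ N + C c * X ^ (2 * N))).coeff (2 * N + σ) = c * P.coeff σ := by
  rw [coeff_mul_trinomial, if_pos (by omega), if_pos (by omega), hP _ (by omega), Nat.add_sub_cancel_left,
    show 2 * N + σ - N = N + σ by omega, hP _ (by omega)]
  ring

/-- Beyond `3N` all coefficients vanish, when `P` lives on `[0,N)`. [folklore] -/
theorem coeff_mul_trinomial_eq_zero (P : ℂ[X]) (N : ℕ) (hP : ∀ m, N ≤ m → P.coeff m = 0) (a b c : ℂ)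
    (m : ℕ) (hm : 3 * N ≤ m) :
    (P * (C a + C b * X ^ N + C c * X ^ (2 * N))).coeff m = 0 := by
  rw [coeff_mul_trinomial, if_pos (by omega), if_pos (by omega), hP _ (by omega), hP _ (by omega), hP _ (by omega)]
  ring

end Trinomial

/-! ## The pattern `Y J = Π_{i<J} (1 + X^{3^i} − X^{2·3^i})` (as a hypothesis) -/

section Pattern

open Polynomial

variable (Y : ℕ → ℂ[X]) (hY0 : Y 0 = 1) (hY : ∀ J, Y (J + 1) = Y J * (1 + X ^ 3 ^ J - X ^ (2 * 3 ^ J)))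

/-- The recursion in trinomial form. [folklore] -/
theorem patY_succ_eq (hY : ∀ J, Y (J + 1) = Y J * (1 + X ^ 3 ^ J - X ^ (2 * 3 ^ J))) (J : ℕ) :
    Y (J + 1) = Y J * (C 1 + C 1 * X ^ 3 ^ J + C (-1) * X ^ (2 * 3 ^ J)) := by
  rw [hY, map_one, map_neg, map_one]; ring

include hY0 hY in
/-- `Y J` lives on `[0, 3^J)`. [folklore] -/
theorem patY_coeff_eq_zero : ∀ (J m : ℕ), 3 ^ J ≤ m → (Y J).coeff m = 0
  | 0, m, hm => by
    rw [hY0, coeff_one, if_neg]; simp at hm; omega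
  | J + 1, m, hm => by
    rw [patY_succ_eq Y hY]
    exact coeff_mul_trinomial_eq_zero _ _ (patY_coeff_eq_zero J) _ _ _ _ (by rw [pow_succ] at hm; omega)

include hY0 hY in
/-- `deg Y J < 3^J`. [folklore] -/
theorem natDegree_patY_lt (J : ℕ) : (Y J).natDegree < 3 ^ J := by
  by_contra h
  rw [not_lt] at h
  by_cases h0 : Y J = 0
  · rw [h0, natDegree_zero] at h
    exact absurd h (not_le.2 (pow_pos (by norm_num) J))
  · exact (leadingCoeff_ne_zero.2 h0) (patY_coeff_eq_zero Y hY0 hY J _ h)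

include hY in
/-- Low digit: `(Y (J+1))_σ = (Y J)_σ`. [folklore] -/
theorem patY_coeff_low (J σ : ℕ) (hσ : σ < 3 ^ J) : (Y (J + 1)).coeff σ = (Y J).coeff σ := by
  rw [patY_succ_eq Y hY, coeff_mul_trinomial_low _ _ _ _ _ _ hσ, one_mul]

include hY0 hY in
/-- Middle digit: `(Y (J+1))_{3^J + σ} = (Y J)_σ`. [folklore] -/
theorem patY_coeff_mid (J σ : ℕ) (hσ : σ < 3 ^ J) : (Y (J + 1)).coeff (3 ^ J + σ) = (Y J).coeff σ := by
  rw [patY_succ_eq Y hY, coeff_mul_trinomial_mid _ _ (patY_coeff_eq_zero Y hY0 hY J) _ _ _ _ hσ, one_mul]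

include hY0 hY in
/-- High digit: `(Y (J+1))_{2·3^J + σ} = −(Y J)_σ`. [folklore] -/
theorem patY_coeff_high (J σ : ℕ) (hσ : σ < 3 ^ J) :
    (Y (J + 1)).coeff (2 * 3 ^ J + σ) = -(Y J).coeff σ := by
  rw [patY_succ_eq Y hY, coeff_mul_trinomial_high _ _ (patY_coeff_eq_zero Y hY0 hY J) _ _ _ _ hσ]
  ring

include hY0 hY in
/-- Every coefficient of `Y J` has modulus `≤ 1` (digits are unique: each coefficient is a single `±1` or `0`).
[folklore] -/
theorem norm_patY_coeff_le_one : ∀ (J n : ℕ), ‖(Y J).coeff n‖ ≤ 1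
  | 0, n => by
    rw [hY0, coeff_one]
    split_ifs <;> simp
  | J + 1, n => by
    have ih := norm_patY_coeff_le_one J
    by_cases h3 : 3 * 3 ^ J ≤ n
    · rw [patY_coeff_eq_zero Y hY0 hY (J + 1) n (by rw [pow_succ]; omega), norm_zero]; exact zero_le_one
    by_cases h2 : 2 * 3 ^ J ≤ n
    · obtain ⟨σ, rfl⟩ := Nat.exists_eq_add_of_le h2
      rw [patY_coeff_high Y hY0 hY J σ (by omega), norm_neg]; exact ih σ
    by_cases h1 : 3 ^ J ≤ n
    · obtain ⟨σ, rfl⟩ := Nat.exists_eq_add_of_le h1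
      rw [patY_coeff_mid Y hY0 hY J σ (by omega)]; exact ih σ
    · rw [patY_coeff_low Y hY J n (by omega)]; exact ih n

/-- **The dual functional evaluated on the pattern**: `Σ_{n < 3^J} z(n) · (Y J)_n = 5^J`
(per digit: `2·1 + 1·1 + (−2)·(−1) = 5`). [folklore] -/
theorem dual_patY (ζ : ℕ → ℝ) (z : ℕ → ℕ → ℝ) (hζ : ζ 0 = 2 ∧ ζ 1 = 1 ∧ ζ 2 = -2 ∧ ∀ e, 3 ≤ e → ζ e = 0)
    (hz0 : ∀ n, z 0 n = if n = 0 then 1 else 0) (hz : ∀ J n, z (J + 1) n = ζ (n / 3 ^ J) * z J (n % 3 ^ J))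
    (hY0 : Y 0 = 1) (hY : ∀ J, Y (J + 1) = Y J * (1 + X ^ 3 ^ J - X ^ (2 * 3 ^ J))) :
    ∀ J : ℕ, ∑ n ∈ range (3 ^ J), (z J n : ℂ) * (Y J).coeff n = 5 ^ J
  | 0 => by simp [hz0, hY0]
  | J + 1 => by
    have ih := dual_patY ζ z hζ hz0 hz hY0 hY J
    set N := 3 ^ J with hN
    set T := ∑ n ∈ range N, (z J n : ℂ) * (Y J).coeff n with hT
    have hblock : ∀ (e : ℕ) (η : ℂ), (∀ σ, σ < N → (Y (J + 1)).coeff (N * e + σ) = η * (Y J).coeff σ) →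
        ∑ σ ∈ range N, (z (J + 1) (N * e + σ) : ℂ) * (Y (J + 1)).coeff (N * e + σ) = (ζ e * η) * T := by
      intro e η hη
      rw [hT, mul_sum]
      refine sum_congr rfl fun σ hσ => ?_
      have hσN : σ < N := mem_range.1 hσ
      rw [cubeZ_succ_apply ζ z hz J e σ hσN, hη σ hσN]
      push_cast; ring
    have h0 := hblock 0 1 (fun σ hσ => by rw [mul_zero, zero_add, one_mul]; exact patY_coeff_low Y hY J σ hσ)
    have h1 := hblock 1 1 (fun σ hσ => by rw [mul_one, one_mul]; exact patY_coeff_mid Y hY0 hY J σ hσ)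
    have h2 := hblock 2 (-1) (fun σ hσ => by
      rw [mul_comm, neg_one_mul]; exact patY_coeff_high Y hY0 hY J σ hσ)
    rw [pow_succ 3 J, sum_range_mul_blocks N _ 3]
    simp only [sum_range_succ, sum_range_zero, zero_add]
    rw [h0, h1, h2, hζ.1, hζ.2.1, hζ.2.2.1, ih]
    push_cast; ring

end Pattern

/-! ## The rank-2 factorisation `Y J = U J · V J` on the cube -/

section Factor

open Polynomial

/-- `(a − X^N)(X^N − b) = 1 + X^N − X^{2N}` when `ab = −1`, `a + b = 1` (golden ratio and conjugate). [folklore] -/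
theorem factor_identity (a b : ℂ) (hab : a * b = -1) (hab' : a + b = 1) (N : ℕ) :
    (C a - X ^ N) * (X ^ N - C b) = (1 + X ^ N - X ^ (2 * N) : ℂ[X]) := by
  have h1 : C a * C b = -1 := by rw [← C_mul, hab, C_neg, C_1]
  have h2 : C a + C b = 1 := by rw [← C_add, hab', C_1]
  linear_combination (X ^ N : ℂ[X]) * h2 - h1

/-- `U J · V J = Y J`. [folklore] -/
theorem patU_mul_patV (a b : ℂ) (hab : a * b = -1) (hab' : a + b = 1) (Y U V : ℕ → ℂ[X])
    (hY0 : Y 0 = 1) (hY : ∀ J, Y (J + 1) = Y J * (1 + X ^ 3 ^ J - X ^ (2 * 3 ^ J)))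
    (hU0 : U 0 = 1) (hU : ∀ J, U (J + 1) = U J * (C a - X ^ 3 ^ J))
    (hV0 : V 0 = 1) (hV : ∀ J, V (J + 1) = V J * (X ^ 3 ^ J - C b)) :
    ∀ J : ℕ, U J * V J = Y J
  | 0 => by rw [hU0, hV0, hY0, one_mul]
  | J + 1 => by
    rw [hU, hV, hY, ← patU_mul_patV a b hab hab' Y U V hY0 hY hU0 hU hV0 hV J, ← factor_identity a b hab hab']
    ring

/-- Support propagation along one binomial block: `supp P ⊆ S J ⇒ supp (P · (a + b X^{3^J})) ⊆ S (J+1)`. [folklore] -/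
theorem support_mul_binomial (S : ℕ → Finset ℕ)
    (hS : ∀ J, S (J + 1) = (range 2 ×ˢ S J).image fun q => 3 ^ J * q.1 + q.2)
    (J : ℕ) (P : ℂ[X]) (hPS : P.support ⊆ S J) (a b : ℂ) :
    (P * (C a + C b * X ^ 3 ^ J)).support ⊆ S (J + 1) := by
  intro m hm
  by_contra hnot
  apply (mem_support_iff.1 hm)
  have e : P * (C a + C b * X ^ 3 ^ J) = C a * P + C b * (P * X ^ 3 ^ J) := by ring
  rw [e, coeff_add, coeff_C_mul, coeff_C_mul, coeff_mul_X_pow']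
  have hPm : P.coeff m = 0 := by
    by_contra hne
    exact hnot ((mem_cube_succ S hS).2 ⟨0, by norm_num, m, hPS (mem_support_iff.2 hne), by ring⟩)
  rw [hPm, mul_zero, zero_add]
  split_ifs with hle
  · have hPm' : P.coeff (m - 3 ^ J) = 0 := by
      by_contra hne
      exact hnot ((mem_cube_succ S hS).2 ⟨1, by norm_num, m - 3 ^ J, hPS (mem_support_iff.2 hne), by omega⟩)
    rw [hPm', mul_zero]
  · rw [mul_zero]

/-- `supp (U J) ⊆ S J` for `U (J+1) = U J · (a − X^{3^J})`, `U 0 = 1`. [folklore] -/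
theorem patU_support (S : ℕ → Finset ℕ) (hS0 : S 0 = {0})
    (hS : ∀ J, S (J + 1) = (range 2 ×ˢ S J).image fun q => 3 ^ J * q.1 + q.2)
    (a : ℂ) (U : ℕ → ℂ[X]) (hU0 : U 0 = 1) (hU : ∀ J, U (J + 1) = U J * (C a - X ^ 3 ^ J)) :
    ∀ J : ℕ, (U J).support ⊆ S J
  | 0 => by
    rw [hU0, hS0, show (1 : ℂ[X]) = C 1 * X ^ 0 by simp]
    exact support_C_mul_X_pow_subset 0 1
  | J + 1 => by
    rw [hU, show C a - X ^ 3 ^ J = C a + C (-1) * X ^ 3 ^ J by rw [map_neg, map_one]; ring]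
    exact support_mul_binomial S hS J _ (patU_support S hS0 hS a U hU0 hU J) _ _

/-- `supp (V J) ⊆ S J` for `V (J+1) = V J · (X^{3^J} − b)`, `V 0 = 1`. [folklore] -/
theorem patV_support (S : ℕ → Finset ℕ) (hS0 : S 0 = {0})
    (hS : ∀ J, S (J + 1) = (range 2 ×ˢ S J).image fun q => 3 ^ J * q.1 + q.2)
    (b : ℂ) (V : ℕ → ℂ[X]) (hV0 : V 0 = 1) (hV : ∀ J, V (J + 1) = V J * (X ^ 3 ^ J - C b)) :
    ∀ J : ℕ, (V J).support ⊆ S J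
  | 0 => by
    rw [hV0, hS0, show (1 : ℂ[X]) = C 1 * X ^ 0 by simp]
    exact support_C_mul_X_pow_subset 0 1
  | J + 1 => by
    rw [hV, show X ^ 3 ^ J - C b = C (-b) + C 1 * X ^ 3 ^ J by rw [map_neg, map_one]; ring]
    exact support_mul_binomial S hS J _ (patV_support S hS0 hS b V hV0 hV J) _ _

/-- The two-squares identity `P Q = ¼(P+Q)² − ¼(P−Q)²` in the stub's format `Σ_i C(c_i) · w_i²`. [folklore] -/
theorem sum_two_squares_eq (P Q : ℂ[X]) :
    (∑ i : Fin 2, C ((![1 / 4, -1 / 4] : Fin 2 → ℂ) i) * ((![P + Q, P - Q] : Fin 2 → ℂ[X]) i) ^ 2) = P * Q := by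
  have h4 : C (1 / 4 : ℂ) * 4 = 1 := by
    rw [show (4 : ℂ[X]) = C 4 from (map_ofNat C 4).symm, ← C_mul]; norm_num
  have hneg : C (-1 / 4 : ℂ) = -C (1 / 4 : ℂ) := by rw [← map_neg]; congr 1; ring
  simp only [Fin.sum_univ_two, Matrix.cons_val_zero, Matrix.cons_val_one, hneg]
  linear_combination (P * Q) * h4

/-- Supports of `P ± Q` stay in `T` when those of `P, Q` do. [folklore] -/
theorem support_two_squares_subset (P Q : ℂ[X]) (T : Finset ℕ) (hP : P.support ⊆ T) (hQ : Q.support ⊆ T) :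
    ∀ i : Fin 2, ((![P + Q, P - Q] : Fin 2 → ℂ[X]) i).support ⊆ T := by
  intro i
  fin_cases i
  · exact (support_add.trans (union_subset hP hQ))
  · simp only [Fin.mk_one, Matrix.cons_val_one]
    rw [sub_eq_add_neg]
    refine support_add.trans (union_subset hP ?_)
    rw [support_neg]; exact hQ

end Factor

end

end Summit.ValiantsHypothesis.ValiantsHypothesis.Theorems.FeketeSOSHard.Negative
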